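import Summits.Ventures.PercRepro.PuncturedLYMSingle
import Summits.Ventures.PercRepro.PuncturedLYMPotential

/-!
# PercRepro — (SP) FOR ONE CODE WORD, PART 2: THE REDUCTION TO THE KIRCHHOFF RECURRENCE (p10, gen 30; continues
PuncturedLYMSingle)

* `tauQ` — `τ = (n − j)/C(n, j+1)`; `ratio_singleton` — `#P/#Y = (j + 1 − τ)/(n − j)` for `{B}`;
* `col_identity_lt`, `col_identity_top` — the recurrence turns the column sums into `(j + 1 − τ)/(n − j)`;
* **`puncturedNMP_single_of_seq`** — (SP) for the single-word code `{B}` whenever a sequence `d` satisfies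
  `m(n−2j−1+m)·d(m−1) − (j+1−m)(j−m)·d m = −τ` (`m < j`), `j(n−j−1)·d(j−1) = 1 − τ`, `0 ≤ d a` and `(j−a)·d a ≤ 1`
  (`a < j`): the radial weights scaled by `c = #P/#Y` have row sums `#Y/#P`, column sums `1`, and are nonnegative — the
  master lemma (`puncturedNMP_of_weights`) finishes.  The explicit sequence `d m = τ·C_{≤m}/N_m` (the flux formula of
  paper §3b, which satisfies all four conditions) is a successor item; with it, (SP) holds for every code with one word.
Nothing here asserts (SP).
-/

namespace PercRepro.PuncturedLYM

open Finset

variable {α : Type} [Fintype α] [DecidableEq α]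

/-! ### The reduction -/

/-- `τ = (n − j) / C(n, j+1)`. -/
def tauQ (α : Type) [Fintype α] (j : ℕ) : ℚ :=
  ((Fintype.card α : ℚ) - j) / ((Fintype.card α).choose (j + 1) : ℕ)

/-- `#P / #Y = (j + 1 − τ)/(n − j)` for the single-word code (`j < n`). -/
theorem ratio_singleton {j : ℕ} {B : Finset α} (hB : B.card = j) (hjn : j < Fintype.card α) :
    ((punctured j ({B} : Finset (Finset α))).card : ℚ) / (levelAbove α j).card =
      ((j : ℚ) + 1 - tauQ α j) / ((Fintype.card α : ℚ) - j) := by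
  have hP : (punctured j ({B} : Finset (Finset α))).card + 1 = (Fintype.card α).choose j := by
    unfold punctured
    have hsub : ({B} : Finset (Finset α)) ⊆ (univ : Finset α).powersetCard j := by
      intro B' hB'
      rw [mem_singleton] at hB'
      rw [hB', mem_powersetCard]
      exact ⟨subset_univ B, hB⟩
    have := card_sdiff_add_card_eq_card hsub
    rw [card_singleton, card_powersetCard, card_univ] at this
    exact this
  have hY : (levelAbove α j).card = (Fintype.card α).choose (j + 1) := by
    unfold levelAbove
    rw [card_powersetCard, card_univ]
  have hch := Nat.choose_succ_right_eq (Fintype.card α) j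
  have hYpos : 0 < (Fintype.card α).choose (j + 1) := Nat.choose_pos hjn
  have hYq : (0 : ℚ) < ((Fintype.card α).choose (j + 1) : ℕ) := by exact_mod_cast hYpos
  have hnj : ((Fintype.card α : ℚ) - j) ≠ 0 := by
    have : (j : ℚ) < Fintype.card α := by exact_mod_cast hjn
    linarith
  have hPq : ((punctured j ({B} : Finset (Finset α))).card : ℚ) = ((Fintype.card α).choose j : ℕ) - 1 := by
    have : (punctured j ({B} : Finset (Finset α))).card = (Fintype.card α).choose j - 1 := by omega
    rw [this, Nat.cast_sub (by omega)]
    push_cast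
    ring
  have hchq : (((Fintype.card α).choose (j + 1) : ℕ) : ℚ) * (j + 1) =
      ((Fintype.card α).choose j : ℕ) * ((Fintype.card α : ℚ) - j) := by
    have : (((Fintype.card α).choose (j + 1) * (j + 1) : ℕ) : ℚ) =
        (((Fintype.card α).choose j * (Fintype.card α - j) : ℕ) : ℚ) := by rw [hch]
    push_cast [Nat.cast_sub hjn.le] at this
    linarith
  rw [hY, hPq]
  unfold tauQ
  rw [div_eq_div_iff hYq.ne' hnj]
  have e : ((j : ℚ) + 1 - ((Fintype.card α : ℚ) - j) / ((Fintype.card α).choose (j + 1) : ℕ)) *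
      ((Fintype.card α).choose (j + 1) : ℕ) =
      ((j : ℚ) + 1) * ((Fintype.card α).choose (j + 1) : ℕ) - ((Fintype.card α : ℚ) - j) := by
    field_simp
  rw [e]
  linear_combination (-1 : ℚ) * hchq

omit [DecidableEq α] in
/-- The column identity for `m < j` from the recurrence: `m·win(m−1) + (j+1−m)·wout m = (j + 1 − τ)/(n − j)`. -/
theorem col_identity_lt {j : ℕ} (d : ℕ → ℚ) {m : ℕ} (hm : m < j)
    (hrec : (m : ℚ) * ((Fintype.card α : ℚ) - 2 * j - 1 + m) * d (m - 1)
      - ((j : ℚ) + 1 - m) * ((j : ℚ) - m) * d m = - tauQ α j) :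
    (m : ℚ) * win α j d (m - 1) + ((j : ℚ) + 1 - m) * wout α j d m =
      ((j : ℚ) + 1 - tauQ α j) / ((Fintype.card α : ℚ) - j) := by
  unfold win wout
  rw [mul_div_assoc', mul_div_assoc', ← add_div]
  congr 1
  rcases Nat.eq_zero_or_pos m with h0 | hpos
  · subst h0
    simp only [CharP.cast_eq_zero, zero_mul, zero_add, sub_zero] at hrec ⊢
    linear_combination hrec
  · have hcast : ((m - 1 : ℕ) : ℚ) = (m : ℚ) - 1 := by
      rw [Nat.cast_sub hpos]
      simp
    rw [hcast]
    linear_combination hrec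

omit [DecidableEq α] in
/-- The column identity for `m = j` from the top recurrence: `j·win(j−1) = (j + 1 − τ)/(n − j)`. -/
theorem col_identity_top {j : ℕ} (d : ℕ → ℚ) (hj : 0 < j)
    (htop : (j : ℚ) * ((Fintype.card α : ℚ) - j - 1) * d (j - 1) = 1 - tauQ α j) :
    (j : ℚ) * win α j d (j - 1) = ((j : ℚ) + 1 - tauQ α j) / ((Fintype.card α : ℚ) - j) := by
  unfold win
  have hcast : ((j - 1 : ℕ) : ℚ) = (j : ℚ) - 1 := by
    rw [Nat.cast_sub hj]
    simp
  rw [hcast, mul_div_assoc']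
  congr 1
  linear_combination htop

/-- **(SP) for the single-word code `{B}` from a sequence `d` with the Kirchhoff recurrence.** -/
theorem puncturedNMP_single_of_seq {j : ℕ} {B : Finset α} (hB : B.card = j) (d : ℕ → ℚ)
    (hrec : ∀ m, m < j → 2 * j + 1 ≤ Fintype.card α + m →
      (m : ℚ) * ((Fintype.card α : ℚ) - 2 * j - 1 + m) * d (m - 1)
        - ((j : ℚ) + 1 - m) * ((j : ℚ) - m) * d m = - tauQ α j)
    (htop : 0 < j → j < Fintype.card α → (j : ℚ) * ((Fintype.card α : ℚ) - j - 1) * d (j - 1) = 1 - tauQ α j)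
    (hnn : ∀ a, a < j → 2 * j ≤ Fintype.card α + a → 0 ≤ d a)
    (hbd : ∀ a, a < j → 2 * j + 1 ≤ Fintype.card α + a → ((j : ℚ) - a) * d a ≤ 1) :
    PuncturedNMP j ({B} : Finset (Finset α)) := by
  intro 𝒜 h𝒜
  rcases Nat.eq_zero_or_pos j with hj0 | hj
  · -- `j = 0`: `P = ∅`
    have hP : punctured j ({B} : Finset (Finset α)) = ∅ := by
      rw [eq_empty_iff_forall_notMem]
      intro X hX
      obtain ⟨hXc, hne⟩ := mem_punctured_singleton.1 hX
      rw [hj0] at hXc hB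
      exact hne ((card_eq_zero.1 hXc).trans (card_eq_zero.1 hB).symm)
    rw [hP, subset_empty] at h𝒜
    subst h𝒜
    simp
  rcases Nat.lt_or_ge j (Fintype.card α) with hjn | hjn
  · -- main case `0 < j < n`: scale the radial weights by `c = #P/#Y`
    have hc := ratio_singleton hB hjn
    set c : ℚ := ((punctured j ({B} : Finset (Finset α))).card : ℚ) / (levelAbove α j).card with hc_def
    have hnj : (0 : ℚ) < (Fintype.card α : ℚ) - j := by
      have : (j : ℚ) < Fintype.card α := by exact_mod_cast hjn
      linarith
    have hcpos : 0 < c := by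
      rw [hc_def]
      apply div_pos
      · -- `#P = C(n,j) − 1 ≥ 1` since `C(n,j) ≥ 2` for `0 < j < n`
        have h2 : 2 ≤ (Fintype.card α).choose j := by
          obtain ⟨n', hn'⟩ : ∃ n', Fintype.card α = n' + 1 := ⟨Fintype.card α - 1, by omega⟩
          obtain ⟨j', hj'⟩ : ∃ j', j = j' + 1 := ⟨j - 1, by omega⟩
          rw [hn', hj', Nat.choose_succ_succ']
          have ha := Nat.choose_pos (n := n') (k := j') (by omega)
          have hb := Nat.choose_pos (n := n') (k := j' + 1) (by omega)
          omega
        have hPc : (punctured j ({B} : Finset (Finset α))).card + 1 = (Fintype.card α).choose j := by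
          unfold punctured
          have hsub : ({B} : Finset (Finset α)) ⊆ (univ : Finset α).powersetCard j := by
            intro B' hB'
            rw [mem_singleton] at hB'
            rw [hB', mem_powersetCard]
            exact ⟨subset_univ B, hB⟩
          have := card_sdiff_add_card_eq_card hsub
          rw [card_singleton, card_powersetCard, card_univ] at this
          exact this
        have : 0 < (punctured j ({B} : Finset (Finset α))).card := by omega
        exact_mod_cast this
      · exact_mod_cast card_levelAbove_pos hjn
    refine puncturedNMP_of_weights (fun X Y => sWp α j d B X Y / c) ?_ ?_ ?_ 𝒜 h𝒜
    · -- nonnegativity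
      intro X hX Y hY
      obtain ⟨hXc, hne⟩ := mem_punctured_singleton.1 hX
      rw [sups_eq hXc] at hY
      obtain ⟨y, hy, rfl⟩ := mem_image.1 hY
      rw [sWp_insert j d B X (mem_sdiff.1 hy).2]
      apply div_nonneg _ hcpos.le
      unfold sW
      have ha := aOf_lt hB hXc hne
      have hXB : (X ∪ B).card ≤ Fintype.card α := card_le_univ _
      have hc2 := card_union_B B X
      rw [hXc, hB] at hc2
      have hn2 : (0 : ℚ) ≤ (Fintype.card α : ℚ) - 2 * j + aOf B X := by
        have : 2 * j ≤ Fintype.card α + aOf B X := by omega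
        have h' : (2 * j : ℚ) ≤ (Fintype.card α : ℚ) + aOf B X := by exact_mod_cast this
        linarith
      have ha2 : 2 * j ≤ Fintype.card α + aOf B X := by omega
      split_ifs with hyB
      · unfold win
        apply div_nonneg _ hnj.le
        have := mul_nonneg hn2 (hnn _ ha ha2)
        linarith
      · unfold wout
        apply div_nonneg _ hnj.le
        -- `y ∉ X ∪ B`: the class `a(X)` is non-empty, `2j + 1 ≤ n + a(X)`
        have hyXB : y ∉ X ∪ B := by
          rw [mem_union, not_or]
          exact ⟨(mem_sdiff.1 hy).2, hyB⟩
        have hlt : (X ∪ B).card < Fintype.card α := by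
          rw [← card_univ]
          exact card_lt_card (ssubset_univ_iff.2 (fun h => hyXB (h ▸ mem_univ y)))
        have ha3 : 2 * j + 1 ≤ Fintype.card α + aOf B X := by omega
        have := hbd _ ha ha3
        linarith
    · -- row sums: `1 / c = #Y / #P`
      intro X hX
      obtain ⟨hXc, -⟩ := mem_punctured_singleton.1 hX
      rw [← sum_div, sum_sups_sW d hB hXc hjn, hc_def, one_div_div]
    · -- column sums: exactly `c`
      intro Y hY
      have hYc := mem_levelAbove.1 hY
      rw [← sum_div, div_le_one hcpos, hc]
      rcases Nat.lt_or_ge (Y ∩ B).card j with hm | hm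
      · have hcls : 2 * j + 1 ≤ Fintype.card α + (Y ∩ B).card := by
          -- `#(Y ∖ B) = j + 1 − m ≤ n − j`
          have h1 := card_sdiff_add_card_inter Y B
          have h2 : (Y \ B).card + B.card ≤ Fintype.card α := by
            rw [← card_union_of_disjoint sdiff_disjoint]
            exact card_le_univ _
          omega
        rw [sum_subsP_sW_lt d hB hYc hm, col_identity_lt d hm (hrec _ hm hcls)]
      · have hBY : B ⊆ Y := by
          have h1 : (Y ∩ B).card = j := le_antisymm (hB ▸ card_le_card inter_subset_right) hm
          have h2 : Y ∩ B = B := eq_of_subset_of_card_le inter_subset_right (by omega)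
          exact h2 ▸ inter_subset_left
        rw [sum_subsP_sW_top d hB hYc hBY, col_identity_top d hj (htop hj hjn)]
  · -- `n ≤ j`: no `(j+1)`-sets
    have : (levelAbove α j).card = 0 := by
      unfold levelAbove
      rw [card_powersetCard, card_univ]
      exact Nat.choose_eq_zero_of_lt (by omega)
    rw [this]
    simp

end PercRepro.PuncturedLYM
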